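import Literature.AnabelianGeometry.AbsoluteAnabelian.AbsTopI.CoFreeCompletionDense
import HarnessLib

/-!
# [AbsTopI] §0 p. 8, continued: functoriality of `Π^{Q/co-fr}` under equivariant automorphisms
# (the "outer action of `J` on `H[l]`" of Prop 4.10 (v))

S. Mochizuki, *Topics in Absolute Anabelian Geometry I* [AbsTopI] (2012), §0 p. 8 and Prop 4.10
(v) p. 61 (manuscript pagination, lit key `paper:url-11ac98ba15fc`): (v)(b) speaks of "the outer
action of `J` on `H[l_i]` [cf. (iv)]" for `H ◁ J`, i.e. of the automorphisms of the co-free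
completion `H[l]` induced by conjugation by elements of `J`.  The construction is NATURAL, and this
file makes the naturality kernel-checked for the data it depends on:

* `Equivariance ρ Δ σ τ` — an automorphism `σ : Π ≃ₜ* Π` of topological groups preserving `Δ`
  together with an automorphism `τ : Q ≃ₜ* Q` with `τ ∘ ρ = ρ ∘ σ` (for `Q` a quotient of the
  profinite completion, `τ` is the automorphism induced by `σ̂`);
* every index `H` (a CHARACTERISTIC open subgroup of finite index of `Δ`) is `σ`-stable
  (`Equivariance.mem_charOpen_iff`), so is `H^{co-fr} = cofreeCore H` (`mem_cofreeCore_iff`, via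
  `cofreeRadical_map_eq`), and `τ` preserves `Ĥ^{co-fr}_Q = coFreeKernel ρ H`
  (`map_mem_coFreeKernel`) — no re-indexing of the limit is needed;
* `CoFreeCompletion.congr h : Π^{Q/co-fr} ≃ₜ* Π^{Q/co-fr}`, the induced automorphism, characterised by
  `congr h (η p) = η (σ p)` on the dense image of `η = toCoFreeCompletion` (`congr_toCoFreeCompletion`);
* the INNER case (`Equivariance.conj`): for `σ = conj(p₀)`, `τ = conj(ρ p₀)` with `p₀` normalising
  `Δ`, `congr` is conjugation by `η(p₀)` (`congr_conj_apply`) — "`H` acts by inner automorphisms",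
  the reason (v)(b) is a condition on the OUTER action.

v2 (cell erratum E-L4-7, re-topologised `CoFreeCompletion`): ONLY the continuity proof inside
`Equivariance.congrHom` changed (checked on the `Π ⧸ K_H`-coordinates); every statement is unchanged.
HONEST FRAMING: general topology; nothing here bears on [IUTchIII] Cor 3.12.
-/

noncomputable section

open Topology

universe u v

namespace Literature.AnabelianGeometry.AbsoluteAnabelian.AbsTopI

variable {P : Type u} [Group P] [TopologicalSpace P]

/-! ### Restricting an automorphism to an invariant subgroup -/

/-- An automorphism `σ` of `Π` with `σ(N) = N`, restricted to `N` as a group automorphism.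
[cite: MochizukiAbsTopI2012, §0 p.8] -/
def restrictMulEquiv (σ : P ≃ₜ* P) (N : Subgroup P) (h : ∀ x, σ x ∈ N ↔ x ∈ N) : N ≃* N where
  toFun x := ⟨σ (x : P), (h x).2 x.2⟩
  invFun x := ⟨σ.symm (x : P), (h (σ.symm (x : P))).1 (by rw [σ.apply_symm_apply]; exact x.2)⟩
  left_inv x := Subtype.ext (σ.symm_apply_apply (x : P))
  right_inv x := Subtype.ext (σ.apply_symm_apply (x : P))
  map_mul' x y := Subtype.ext (map_mul σ (x : P) y)

/-- An automorphism `σ` of the topological group `Π` with `σ(N) = N`, restricted to `N` as an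
automorphism of the topological group `N`. [cite: MochizukiAbsTopI2012, §0 p.8] -/
def restrictEquiv (σ : P ≃ₜ* P) (N : Subgroup P) (h : ∀ x, σ x ∈ N ↔ x ∈ N) : N ≃ₜ* N :=
  { restrictMulEquiv σ N h with
    continuous_toFun := (σ.continuous.comp continuous_subtype_val).subtype_mk _
    continuous_invFun := (σ.symm.continuous.comp continuous_subtype_val).subtype_mk _ }

/-- Formula for the restriction. [cite: MochizukiAbsTopI2012, §0 p.8] -/
@[simp] theorem coe_restrictEquiv (σ : P ≃ₜ* P) (N : Subgroup P) (h : ∀ x, σ x ∈ N ↔ x ∈ N) (x : N) :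
    ((restrictEquiv σ N h x : N) : P) = σ (x : P) := rfl

/-- If `σ(N) = N` and `K ≤ N` is stable under every automorphism of the topological group `N`
(characteristic), then `σ(K) = K`. [cite: MochizukiAbsTopI2012, §0 p.8] -/
theorem mem_iff_of_map_restrict_eq {N K : Subgroup P} (hK : K ≤ N) (σ : P ≃ₜ* P)
    (hσ : ∀ x, σ x ∈ N ↔ x ∈ N)
    (hchar : ∀ α : N ≃ₜ* N, (K.subgroupOf N).map α.toMulEquiv.toMonoidHom = K.subgroupOf N)
    (x : P) : σ x ∈ K ↔ x ∈ K := by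
  by_cases hx : x ∈ N
  · constructor
    · intro hσx
      have hmem : (⟨σ x, (hσ x).2 hx⟩ : N) ∈ K.subgroupOf N := by
        rw [Subgroup.mem_subgroupOf]; exact hσx
      have himg : (restrictEquiv σ N hσ).symm ⟨σ x, (hσ x).2 hx⟩ ∈
          (K.subgroupOf N).map (restrictEquiv σ N hσ).symm.toMulEquiv.toMonoidHom :=
        ⟨_, hmem, rfl⟩
      rw [hchar, Subgroup.mem_subgroupOf] at himg
      change σ.symm (σ x) ∈ K at himg
      rwa [σ.symm_apply_apply] at himg
    · intro hxK
      have hmem : (⟨x, hx⟩ : N) ∈ K.subgroupOf N := by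
        rw [Subgroup.mem_subgroupOf]; exact hxK
      have himg : restrictEquiv σ N hσ ⟨x, hx⟩ ∈
          (K.subgroupOf N).map (restrictEquiv σ N hσ).toMulEquiv.toMonoidHom :=
        ⟨_, hmem, rfl⟩
      rw [hchar, Subgroup.mem_subgroupOf] at himg
      exact himg
  · constructor
    · intro hσx
      exact absurd ((hσ x).1 (hK hσx)) hx
    · intro hxK
      exact absurd (hK hxK) hx

/-- An automorphism `β` of a topological group `G` preserving a normal subgroup `N` DESCENDS to an
automorphism of the topological group `G ⧸ N`. [cite: MochizukiAbsTopI2012, §0 p.8] -/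
def quotientEquivOfInvariant {G : Type*} [Group G] [TopologicalSpace G] [IsTopologicalGroup G]
    (N : Subgroup G) [N.Normal] (β : G ≃ₜ* G) (h : ∀ x, β x ∈ N ↔ x ∈ N) : G ⧸ N ≃ₜ* G ⧸ N :=
  have h₁ : N ≤ N.comap β.toMulEquiv.toMonoidHom := fun x hx => (h x).2 hx
  have h₂ : N ≤ N.comap β.symm.toMulEquiv.toMonoidHom := fun x hx => by
    have := h (β.symm x)
    rw [β.apply_symm_apply] at this
    exact this.1 hx
  { QuotientGroup.map N N β.toMulEquiv.toMonoidHom h₁ with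
    toFun := QuotientGroup.map N N β.toMulEquiv.toMonoidHom h₁
    invFun := QuotientGroup.map N N β.symm.toMulEquiv.toMonoidHom h₂
    left_inv := fun y => by
      obtain ⟨x, rfl⟩ := QuotientGroup.mk_surjective y
      rw [QuotientGroup.map_mk, QuotientGroup.map_mk]
      exact congrArg QuotientGroup.mk (β.symm_apply_apply x)
    right_inv := fun y => by
      obtain ⟨x, rfl⟩ := QuotientGroup.mk_surjective y
      rw [QuotientGroup.map_mk, QuotientGroup.map_mk]
      exact congrArg QuotientGroup.mk (β.apply_symm_apply x)
    continuous_toFun := by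
      apply (QuotientGroup.isOpenQuotientMap_mk (N := N)).continuous_comp_iff.mp
      exact QuotientGroup.continuous_mk.comp β.continuous
    continuous_invFun := by
      apply (QuotientGroup.isOpenQuotientMap_mk (N := N)).continuous_comp_iff.mp
      exact QuotientGroup.continuous_mk.comp β.symm.continuous }

/-- The descended automorphism on classes. [cite: MochizukiAbsTopI2012, §0 p.8] -/
@[simp] theorem quotientEquivOfInvariant_mk {G : Type*} [Group G] [TopologicalSpace G]
    [IsTopologicalGroup G] (N : Subgroup G) [N.Normal] (β : G ≃ₜ* G) (h : ∀ x, β x ∈ N ↔ x ∈ N)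
    (x : G) : quotientEquivOfInvariant N β h (x : G ⧸ N) = (β x : G ⧸ N) := rfl

/-! ### Equivariant automorphism pairs and the stability of the indices -/

section Functorial

variable {Q : Type v} [Group Q] [TopologicalSpace Q] [IsTopologicalGroup Q]
  (ρ : P →ₜ* Q) (Δ : Subgroup P)

/-- An EQUIVARIANT PAIR of automorphisms for the data `(ρ : Π → Q, Δ)` of the co-free completion:
`σ : Π ≃ₜ* Π` with `σ(Δ) = Δ` and `τ : Q ≃ₜ* Q` with `τ ∘ ρ = ρ ∘ σ` (for `Q` a quotient of `Π̂`
by a characteristic subgroup, `τ` is induced by `σ̂`; for `σ = conj(j)`, `τ = conj(ρ j)`).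
[cite: MochizukiAbsTopI2012, §0 p.8] -/
structure Equivariance (σ : P ≃ₜ* P) (τ : Q ≃ₜ* Q) : Prop where
  /-- `σ(Δ) = Δ` -/
  mem_iff : ∀ x, σ x ∈ Δ ↔ x ∈ Δ
  /-- `τ ∘ ρ = ρ ∘ σ` -/
  comm : ∀ p, τ (ρ p) = ρ (σ p)

variable {ρ Δ} {σ : P ≃ₜ* P} {τ : Q ≃ₜ* Q}

omit [IsTopologicalGroup Q] in
/-- The inverse pair is equivariant. [cite: MochizukiAbsTopI2012, §0 p.8] -/
theorem Equivariance.symm (h : Equivariance ρ Δ σ τ) : Equivariance ρ Δ σ.symm τ.symm where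
  mem_iff x := by
    have := h.mem_iff (σ.symm x)
    rw [σ.apply_symm_apply] at this
    exact this.symm
  comm p := by
    apply τ.injective
    rw [τ.apply_symm_apply, h.comm, σ.apply_symm_apply]

omit [IsTopologicalGroup Q] in
/-- **Every index is `σ`-stable**: a characteristic open subgroup `H` of finite index of `Δ` satisfies
`σ(H) = H` for every automorphism `σ` of `Π` preserving `Δ` (`σ|_Δ` is an automorphism of the
topological group `Δ`). [cite: MochizukiAbsTopI2012, §0 p.8] -/
theorem Equivariance.mem_charOpen_iff (h : Equivariance ρ Δ σ τ) (H : CharOpenSubgroup Δ) (x : P) :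
    σ x ∈ H.toSubgroup ↔ x ∈ H.toSubgroup :=
  mem_iff_of_map_restrict_eq H.le σ h.mem_iff H.map_eq x

omit [IsTopologicalGroup Q] in
/-- `σ(H^{co-fr}) = H^{co-fr}` for every index `H` (the co-free core is characteristic in `H`,
`cofreeRadical_map_eq`). [cite: MochizukiAbsTopI2012, §0 p.8] -/
theorem Equivariance.mem_cofreeCore_iff (h : Equivariance ρ Δ σ τ) (H : CharOpenSubgroup Δ) (x : P) :
    σ x ∈ cofreeCore H.toSubgroup ↔ x ∈ cofreeCore H.toSubgroup := by
  refine mem_iff_of_map_restrict_eq (cofreeCore_le H.toSubgroup) σ (h.mem_charOpen_iff H) ?_ x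
  intro α
  rw [cofreeCore_subgroupOf_eq]
  exact cofreeRadical_map_eq α

/-- `τ(Ĥ^{co-fr}_Q) ⊆ Ĥ^{co-fr}_Q`: `τ` maps `ρ(H^{co-fr})` into itself (equivariance), hence its
normal closure, hence the closure. [cite: MochizukiAbsTopI2012, §0 p.8] -/
theorem Equivariance.map_mem_coFreeKernel (h : Equivariance ρ Δ σ τ) (H : CharOpenSubgroup Δ)
    {n : Q} (hn : n ∈ coFreeKernel ρ H.toSubgroup) : τ n ∈ coFreeKernel ρ H.toSubgroup := by
  -- the normal closure of `ρ(H^{co-fr})` is mapped into itself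
  have hs : Set.MapsTo τ (ρ '' (cofreeCore H.toSubgroup : Set P))
      (ρ '' (cofreeCore H.toSubgroup : Set P)) := by
    rintro _ ⟨x, hx, rfl⟩
    exact ⟨σ x, (h.mem_cofreeCore_iff H x).2 hx, (h.comm x).symm⟩
  have hN : Set.MapsTo τ
      (Subgroup.normalClosure (ρ '' (cofreeCore H.toSubgroup : Set P)) : Set Q)
      (Subgroup.normalClosure (ρ '' (cofreeCore H.toSubgroup : Set P)) : Set Q) := by
    intro m hm
    have h1 : τ.toMulEquiv.toMonoidHom m ∈
        (Subgroup.normalClosure (ρ '' (cofreeCore H.toSubgroup : Set P))).map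
          τ.toMulEquiv.toMonoidHom := ⟨m, hm, rfl⟩
    have h2 := Subgroup.map_normalClosure_le (ρ '' (cofreeCore H.toSubgroup : Set P))
      τ.toMulEquiv.toMonoidHom h1
    exact Subgroup.normalClosure_mono hs.image_subset h2
  exact hN.closure τ.continuous hn

/-- The automorphism of `Q/Ĥ^{co-fr}_Q` induced by `τ`, as a continuous homomorphism.
[cite: MochizukiAbsTopI2012, §0 p.8] -/
def Equivariance.quotMap (h : Equivariance ρ Δ σ τ) (H : CharOpenSubgroup Δ) :
    CoFreeQuot ρ H.toSubgroup →ₜ* CoFreeQuot ρ H.toSubgroup where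
  toMonoidHom := QuotientGroup.map _ _ τ.toMulEquiv.toMonoidHom
    (fun n hn => h.map_mem_coFreeKernel H hn)
  continuous_toFun := by
    apply (QuotientGroup.isOpenQuotientMap_mk (N := coFreeKernel ρ H.toSubgroup)).continuous_comp_iff.mp
    exact QuotientGroup.continuous_mk.comp τ.continuous

/-- The induced map on classes. [cite: MochizukiAbsTopI2012, §0 p.8] -/
@[simp] theorem Equivariance.quotMap_mk (h : Equivariance ρ Δ σ τ) (H : CharOpenSubgroup Δ) (q : Q) :
    h.quotMap H (q : CoFreeQuot ρ H.toSubgroup) = (τ q : CoFreeQuot ρ H.toSubgroup) := rfl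

/-- The induced ENDOmorphism of `Π^{Q/co-fr}` (coordinatewise `τ`), a continuous homomorphism.
[cite: MochizukiAbsTopI2012, §0 p.8] -/
def Equivariance.congrHom (h : Equivariance ρ Δ σ τ) : CoFreeCompletion ρ Δ →ₜ* CoFreeCompletion ρ Δ where
  toFun x := ⟨fun H => h.quotMap H (x.val H), by
    refine ⟨fun H H' hle => ?_, fun H => ?_⟩
    · change transition ρ hle (h.quotMap H' (x.val H')) = h.quotMap H (x.val H)
      obtain ⟨q, hq⟩ := QuotientGroup.mk_surjective (x.val H')
      have hc := x.transition_val hle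
      rw [← hq] at hc ⊢
      rw [transition_mk] at hc
      rw [Equivariance.quotMap_mk, transition_mk, ← hc, Equivariance.quotMap_mk]
    · change ∃ p, toCoFreeQuot ρ H.toSubgroup p = h.quotMap H (x.val H)
      obtain ⟨p, hp⟩ := x.exists_toCoFreeQuot_eq_val H
      refine ⟨σ p, ?_⟩
      rw [← hp, toCoFreeQuot_apply, toCoFreeQuot_apply, Equivariance.quotMap_mk, h.comm]⟩
  map_one' := by
    apply CoFreeCompletion.ext
    intro H
    exact map_one (h.quotMap H)
  map_mul' x y := by
    apply CoFreeCompletion.ext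
    intro H
    exact map_mul (h.quotMap H) (x.val H) (y.val H)
  continuous_toFun := by
    refine (CoFreeCompletion.continuous_iff_kerCoord _).2 fun H => ?_ -- v2 (E-L4-7): coordinatewise
    have hquot (p : P) : h.quotMap H (toCoFreeQuot ρ H.toSubgroup p) = toCoFreeQuot ρ H.toSubgroup (σ p) := by
      rw [toCoFreeQuot_apply, toCoFreeQuot_apply, Equivariance.quotMap_mk, h.comm]
    have hK : CoFreeCompletion.piKer ρ Δ H ≤ (CoFreeCompletion.piKer ρ Δ H).comap σ.toMulEquiv.toMonoidHom := by
      intro p hp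
      rw [Subgroup.mem_comap, MonoidHom.mem_ker]; rw [MonoidHom.mem_ker] at hp
      change toCoFreeQuot ρ H.toSubgroup (σ p) = 1
      rw [← hquot, show toCoFreeQuot ρ H.toSubgroup p = 1 from hp, map_one]
    have hσH : Continuous (QuotientGroup.map _ _ σ.toMulEquiv.toMonoidHom hK) := by
      rw [(QuotientGroup.isQuotientMap_mk (CoFreeCompletion.piKer ρ Δ H)).continuous_iff]
      exact QuotientGroup.continuous_mk.comp σ.continuous
    refine (hσH.comp (CoFreeCompletion.continuous_kerCoord H)).congr fun x => ?_
    obtain ⟨p, hp⟩ := x.exists_toCoFreeQuot_eq_val H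
    have aux : ∀ y : CoFreeCompletion ρ Δ, y.val H = h.quotMap H (x.val H) → CoFreeCompletion.kerCoord H y =
        QuotientGroup.map _ _ σ.toMulEquiv.toMonoidHom hK (CoFreeCompletion.kerCoord H x) := fun y hy => by
      rw [CoFreeCompletion.kerCoord_eq_mk hp, CoFreeCompletion.kerCoord_eq_mk (p := σ p) (by rw [hy, ← hp, hquot])]
      rfl
    exact (aux _ rfl).symm

/-- Coordinates of the induced endomorphism. [cite: MochizukiAbsTopI2012, §0 p.8] -/
@[simp] theorem Equivariance.val_congrHom (h : Equivariance ρ Δ σ τ) (x : CoFreeCompletion ρ Δ)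
    (H : CharOpenSubgroup Δ) : (h.congrHom x).val H = h.quotMap H (x.val H) := rfl

/-- **Naturality on the dense image**: `congr(η p) = η(σ p)`. [cite: MochizukiAbsTopI2012, §0 p.8] -/
theorem Equivariance.congrHom_toCoFreeCompletion (h : Equivariance ρ Δ σ τ) (p : P) :
    h.congrHom (toCoFreeCompletion ρ Δ p) = toCoFreeCompletion ρ Δ (σ p) := by
  apply CoFreeCompletion.ext
  intro H
  rw [Equivariance.val_congrHom, val_toCoFreeCompletion, val_toCoFreeCompletion, toCoFreeQuot_apply,
    toCoFreeQuot_apply, Equivariance.quotMap_mk, h.comm]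

/-- The endomorphisms induced by a pair and by its inverse pair are mutually inverse.
[cite: MochizukiAbsTopI2012, §0 p.8] -/
theorem Equivariance.congrHom_symm_apply (h : Equivariance ρ Δ σ τ) (x : CoFreeCompletion ρ Δ) :
    h.congrHom (h.symm.congrHom x) = x := by
  apply CoFreeCompletion.ext
  intro H
  rw [Equivariance.val_congrHom, Equivariance.val_congrHom]
  obtain ⟨q, hq⟩ := QuotientGroup.mk_surjective (x.val H)
  rw [← hq, Equivariance.quotMap_mk, Equivariance.quotMap_mk, τ.apply_symm_apply]

/-- Idem, in the other order. [cite: MochizukiAbsTopI2012, §0 p.8] -/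
theorem Equivariance.symm_congrHom_apply (h : Equivariance ρ Δ σ τ) (x : CoFreeCompletion ρ Δ) :
    h.symm.congrHom (h.congrHom x) = x := by
  apply CoFreeCompletion.ext
  intro H
  rw [Equivariance.val_congrHom, Equivariance.val_congrHom]
  obtain ⟨q, hq⟩ := QuotientGroup.mk_surjective (x.val H)
  rw [← hq, Equivariance.quotMap_mk, Equivariance.quotMap_mk, τ.symm_apply_apply]

/-- **The induced AUTOMORPHISM `Π^{Q/co-fr} ≃ₜ* Π^{Q/co-fr}`** of an equivariant pair `(σ, τ)`
(functoriality of the `(Q, Δ)`-co-free completion of [AbsTopI] §0 p. 8 under automorphisms; the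
"outer action of `J` on `H[l]`" of Prop 4.10 (v) is made of these). [cite: MochizukiAbsTopI2012, §0 p.8] -/
def Equivariance.congr (h : Equivariance ρ Δ σ τ) : CoFreeCompletion ρ Δ ≃ₜ* CoFreeCompletion ρ Δ :=
  { h.congrHom.toMonoidHom.toMulHom with
    toFun := h.congrHom
    invFun := h.symm.congrHom
    left_inv := h.symm_congrHom_apply
    right_inv := h.congrHom_symm_apply
    continuous_toFun := h.congrHom.continuous
    continuous_invFun := h.symm.congrHom.continuous }

/-- The induced automorphism is the induced endomorphism. [cite: MochizukiAbsTopI2012, §0 p.8] -/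
@[simp] theorem Equivariance.congr_apply (h : Equivariance ρ Δ σ τ) (x : CoFreeCompletion ρ Δ) :
    h.congr x = h.congrHom x := rfl

/-- **Naturality**: `congr(η p) = η(σ p)`; since `η` has dense image (`denseRange_toCoFreeCompletion`)
and `Π^{Q/co-fr}` is Hausdorff whenever the `Q/Ĥ^{co-fr}_Q` are, this characterises `congr`.
[cite: MochizukiAbsTopI2012, §0 p.8] -/
theorem Equivariance.congr_toCoFreeCompletion (h : Equivariance ρ Δ σ τ) (p : P) :
    h.congr (toCoFreeCompletion ρ Δ p) = toCoFreeCompletion ρ Δ (σ p) :=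
  h.congrHom_toCoFreeCompletion p

/-- If `τ` happens to be conjugation by `ρ p₀` (whatever `σ` is), the induced endomorphism of
`Π^{Q/co-fr}` is conjugation by `η p₀`: coordinatewise, `τ` acts on `Q/Ĥ^{co-fr}_Q` as conjugation by
the image of `ρ p₀`. [cite: MochizukiAbsTopI2012, §0 p.8] -/
theorem Equivariance.congrHom_eq_conj_of (h : Equivariance ρ Δ σ τ) (p₀ : P)
    (hτ : ∀ q, τ q = ρ p₀ * q * (ρ p₀)⁻¹) (x : CoFreeCompletion ρ Δ) :
    h.congrHom x = toCoFreeCompletion ρ Δ p₀ * x * (toCoFreeCompletion ρ Δ p₀)⁻¹ := by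
  apply CoFreeCompletion.ext
  intro H
  rw [Equivariance.val_congrHom]
  obtain ⟨q, hq⟩ := QuotientGroup.mk_surjective (x.val H)
  change _ = (toCoFreeCompletion ρ Δ p₀).val H * x.val H * ((toCoFreeCompletion ρ Δ p₀).val H)⁻¹
  rw [← hq, Equivariance.quotMap_mk, hτ, val_toCoFreeCompletion, toCoFreeQuot_apply]
  rfl

end Functorial

/-! ### The pro-`l` kernel is characteristic (automorphisms descend to `G^{(l)}`) -/

section ProL

variable (G : Type*) [Group G] [TopologicalSpace G]

/-- Membership in the pro-`l` kernel: lying in every open normal subgroup of `l`-power index.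
[cite: MochizukiAbsTopI2012, Prop 4.10 (iv) p.60] -/
theorem mem_proPrimeKer_iff {l : ℕ} {x : G} :
    x ∈ proPrimeKer G l ↔
      ∀ N : Subgroup G, N.Normal → IsOpen (N : Set G) → (∃ k : ℕ, N.index = l ^ k) → x ∈ N := by
  constructor
  · intro hx N hN hO hk
    exact proPrimeKer_le G ⟨⟨N, hO⟩, hN⟩ hk hx
  · intro h
    exact Subgroup.mem_iInf.2 fun N => h _ N.1.isNormal' N.1.isOpen' N.2

/-- The pro-`l` kernel is CHARACTERISTIC for the topological group structure: stable under every
`G ≃ₜ* G` (an automorphism permutes the open normal subgroups of `l`-power index).  Hence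
automorphisms of `G` descend to `G^{(l)}`. [cite: MochizukiAbsTopI2012, Prop 4.10 (iv) p.60] -/
theorem mem_proPrimeKer_iff_of_continuousMulEquiv [IsTopologicalGroup G] (α : G ≃ₜ* G) {l : ℕ}
    (x : G) : α x ∈ proPrimeKer G l ↔ x ∈ proPrimeKer G l := by
  rw [mem_proPrimeKer_iff, mem_proPrimeKer_iff]
  constructor
  · intro h N hN hO hk
    have hN' : (N.comap α.symm.toMulEquiv.toMonoidHom).Normal := hN.comap _
    have hO' : IsOpen (N.comap α.symm.toMulEquiv.toMonoidHom : Set G) := hO.preimage α.symm.continuous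
    have hk' : ∃ k : ℕ, (N.comap α.symm.toMulEquiv.toMonoidHom).index = l ^ k := by
      rw [Subgroup.index_comap_of_surjective _ α.symm.surjective]; exact hk
    have := h _ hN' hO' hk'
    rw [Subgroup.mem_comap] at this
    change α.symm (α x) ∈ N at this
    rwa [α.symm_apply_apply] at this
  · intro h N hN hO hk
    have hN' : (N.comap α.toMulEquiv.toMonoidHom).Normal := hN.comap _
    have hO' : IsOpen (N.comap α.toMulEquiv.toMonoidHom : Set G) := hO.preimage α.continuous
    have hk' : ∃ k : ℕ, (N.comap α.toMulEquiv.toMonoidHom).index = l ^ k := by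
      rw [Subgroup.index_comap_of_surjective _ α.surjective]; exact hk
    exact h _ hN' hO' hk'

end ProL

/-! ### The inner case: conjugation -/

section Inner

/-- Conjugation by `g` as an automorphism of a topological group. [cite: MochizukiAbsTopI2012, §0 p.8] -/
def conjEquiv {G : Type*} [Group G] [TopologicalSpace G] [IsTopologicalGroup G] (g : G) : G ≃ₜ* G :=
  { MulAut.conj g with
    continuous_toFun := (continuous_const.mul continuous_id).mul continuous_const
    continuous_invFun := (continuous_const.mul continuous_id).mul continuous_const }

/-- Formula for conjugation. [cite: MochizukiAbsTopI2012, §0 p.8] -/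
@[simp] theorem conjEquiv_apply {G : Type*} [Group G] [TopologicalSpace G] [IsTopologicalGroup G]
    (g x : G) : conjEquiv g x = g * x * g⁻¹ := rfl

variable [IsTopologicalGroup P] {Q : Type v} [Group Q] [TopologicalSpace Q] [IsTopologicalGroup Q]
  (ρ : P →ₜ* Q) (Δ : Subgroup P)

/-- Conjugation by an element `p₀` normalising `Δ`, paired with conjugation by `ρ p₀`, is an
equivariant pair. [cite: MochizukiAbsTopI2012, §0 p.8] -/
theorem Equivariance.conj (p₀ : P) (h₀ : ∀ x, p₀ * x * p₀⁻¹ ∈ Δ ↔ x ∈ Δ) :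
    Equivariance ρ Δ (conjEquiv p₀) (conjEquiv (ρ p₀)) where
  mem_iff x := by rw [conjEquiv_apply]; exact h₀ x
  comm p := by rw [conjEquiv_apply, conjEquiv_apply, map_mul, map_mul, map_inv]

/-- **Inner automorphisms act innerly**: the automorphism of `Π^{Q/co-fr}` induced by conjugation by
`p₀` is conjugation by `η(p₀)` ("`H` acts by inner automorphisms on `H[l]`", the reason [AbsTopI]
Prop 4.10 (v)(b) constrains only the OUTER action). [cite: MochizukiAbsTopI2012, Prop 4.10 (v) p.61] -/
theorem Equivariance.congr_conj_apply (p₀ : P) (h₀ : ∀ x, p₀ * x * p₀⁻¹ ∈ Δ ↔ x ∈ Δ)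
    (x : CoFreeCompletion ρ Δ) :
    (Equivariance.conj ρ Δ p₀ h₀).congr x =
      toCoFreeCompletion ρ Δ p₀ * x * (toCoFreeCompletion ρ Δ p₀)⁻¹ :=
  (Equivariance.conj ρ Δ p₀ h₀).congrHom_eq_conj_of p₀ (fun _ => rfl) x

end Inner

end Literature.AnabelianGeometry.AbsoluteAnabelian.AbsTopI
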